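import Summits.ResolutionOfSingularities.ResolutionOfSingularities.Theorems.MaxContactCutConeJump
import Literature.AlgebraicGeometry.Resolution.RegularLocalOrder

/-!
# PinchTower (P1/8) — local algebra for ENGINE (M) `MonomialPinchExit`: quotients of frames, THE PINCH ORDER BOUND

Node «PinchTower» of `decomp-res-lens-2` (g31): the hypothesis-free proof of `PinchCut.MonomialPinchExit` — the monomial
pinch `zⁿ + λ vᵏ uᵐ + g`, `m = qn + r`, blown up `q` times in the sections `V(z_j, u)`; main theorem in
`Theorems/MaxContactCutPinchTower.lean`.  All exits of the tower are read by ORDER ARITHMETIC in regular local rings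
(no graded rings except at the non-power point (E34)):

* §Q the image of `𝔪` in a local quotient, membership pulled back (`mk a ∈ 𝔪̄ᵏ ↔ a ∈ K + 𝔪ᵏ`), and the tail of a part of
  a regular system of parameters is one modulo its head (`isRsopPart_tail_quotient`, Matsumura 14.2);
* §O THE PINCH ORDER BOUND `pinch_not_mem_pow`: `(z, u)` an r.s.o.p.-part (and `(z, u, v)` if `k > 0`), `λ` a unit ⇒
  `uʳ·(λ vᵏ + u·s) + z·b ∉ 𝔪^{r+k+1}` — modulo `z`, then modulo `(z, u)`, by additivity of orders
  (`RegularLocalOrder.mul_not_mem_pow_of_not_mem_pow`);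
* (P2 `PinchTowerTau`) `τ ≤ 1 ⇒ h ≡ c·ℓⁿ (mod 𝔪ⁿ⁺¹)` and THE MIXED EXIT (E12) `k + r = n`.

Sources: [Hironaka1964] Ch. III; [CossartJannsenSaito2020] Ch. 2 (directrix, `τ`); [CossartPiltant2008] Prop. 4.2;
Matsumura, Commutative Ring Theory, Thms. 14.2, 14.3, 17.10.
-/

open IsLocalRing
open Literature.AlgebraicGeometry.Resolution

namespace Summit.ResolutionOfSingularities.ResolutionOfSingularities.Theorems.PinchTower

/-! ## §Q  Local quotients: the image of `𝔪`, tails of regular systems of parameters -/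

section Quot

variable {S : Type} [CommRing S] [IsLocalRing S]

/-- The image of `𝔪` in a local quotient is the maximal ideal. [folklore] -/
theorem map_mk_maximalIdeal_eq (K : Ideal S) [IsLocalRing (S ⧸ K)] :
    (maximalIdeal S).map (Ideal.Quotient.mk K) = maximalIdeal (S ⧸ K) := by
  refine le_antisymm (ConeJump.map_mk_maximalIdeal_le K) ?_
  rcases Ideal.map_eq_top_or_isMaximal_of_surjective (Ideal.Quotient.mk K) Ideal.Quotient.mk_surjective
      (maximalIdeal.isMaximal S) with h | h
  · exact h ▸ le_top
  · exact le_of_eq (IsLocalRing.eq_maximalIdeal h).symm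

/-- Membership pulled back from a local quotient: `mk a ∈ 𝔪̄ᵏ ↔ a ∈ K + 𝔪ᵏ`. [folklore] -/
theorem mk_mem_pow_maximalIdeal_iff (K : Ideal S) [IsLocalRing (S ⧸ K)] (a : S) (k : ℕ) :
    Ideal.Quotient.mk K a ∈ maximalIdeal (S ⧸ K) ^ k ↔ a ∈ K ⊔ maximalIdeal S ^ k := by
  rw [← map_mk_maximalIdeal_eq K, ← Ideal.map_pow,
    Ideal.mem_map_iff_of_surjective _ Ideal.Quotient.mk_surjective]
  constructor
  · rintro ⟨b, hb, hab⟩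
    rw [Ideal.Quotient.eq] at hab
    have : a = b - (b - a) := by ring
    rw [this]
    exact Ideal.sub_mem _ (Ideal.mem_sup_right hb) (Ideal.mem_sup_left hab)
  · intro h
    obtain ⟨x, hx, y, hy, rfl⟩ := Submodule.mem_sup.mp h
    refine ⟨y, hy, ?_⟩
    rw [Ideal.Quotient.eq]
    simpa using K.neg_mem hx

/-- The local quotient by a proper ideal is local (as an explicit term, for quotients by frames). [folklore] -/
theorem isLocalRing_quotient {K : Ideal S} (hK : K ≤ maximalIdeal S) : IsLocalRing (S ⧸ K) :=
  haveI : Nontrivial (S ⧸ K) :=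
    Ideal.Quotient.nontrivial_iff.mpr fun h => (maximalIdeal.isMaximal S).ne_top (top_le_iff.mp (h ▸ hK))
  IsLocalRing.of_surjective' (Ideal.Quotient.mk K) Ideal.Quotient.mk_surjective

-- WRITER NOTE (decomp-res writer-1 g15): the lens's `range_fin_append'` restated the landed
-- `Set.range_fin_append` [WildQuotientsSummitReductionStubPairOrbitNormalFormBlowupModelCharts7] (gate `dedup.landed`);
-- deleted — its one use below calls Literature's `range_fin_append` [AlterationsEnlargingZ], already in scope.

/-- **The tail of a part of a regular system of parameters is one modulo its head**: if `(f, c)` is part of a regular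
system of parameters of `S`, the images `c̄` form part of one of `S/(f)` — `S/(f)` and `S/(f, c) ≅ (S/(f))/(c̄)` are
regular local of dimensions `dim S − p` and `dim S − p − q` (Matsumura 14.2), and the criterion
`IsRsopPart.of_isRegularLocalRing_quotient` applies. [cite: Matsumura1987, Thm. 14.2] -/
theorem isRsopPart_tail_quotient [IsNoetherianRing S] {p q : ℕ} {f : Fin p → S} {c : Fin q → S}
    (h : IsRsopPart (Fin.append f c)) [IsLocalRing (S ⧸ Ideal.span (Set.range f))] :
    IsRsopPart (fun j => Ideal.Quotient.mk (Ideal.span (Set.range f)) (c j)) := by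
  classical
  have hf : IsRsopPart f := h.append_left
  have hrange : Set.range (fun j => Ideal.Quotient.mk (Ideal.span (Set.range f)) (c j)) =
      Ideal.Quotient.mk (Ideal.span (Set.range f)) '' Set.range c := by
    ext b
    simp only [Set.mem_range, Set.mem_image, exists_exists_eq_and]
  have hmap : Ideal.span (Set.range fun j => Ideal.Quotient.mk (Ideal.span (Set.range f)) (c j)) =
      (Ideal.span (Set.range c)).map (Ideal.Quotient.mk (Ideal.span (Set.range f))) := by
    rw [Ideal.map_span, hrange]
  have hsup : Ideal.span (Set.range f) ⊔ Ideal.span (Set.range c) = Ideal.span (Set.range (Fin.append f c)) := by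
    rw [← Ideal.span_union, range_fin_append]
  let e : (S ⧸ Ideal.span (Set.range f)) ⧸
      Ideal.span (Set.range fun j => Ideal.Quotient.mk (Ideal.span (Set.range f)) (c j)) ≃+*
      S ⧸ Ideal.span (Set.range (Fin.append f c)) :=
    (Ideal.quotEquivOfEq hmap).trans
      ((DoubleQuot.quotQuotEquivQuotSup (Ideal.span (Set.range f)) (Ideal.span (Set.range c))).trans
        (Ideal.quotEquivOfEq hsup))
  haveI hreg2 : IsRegularLocalRing (S ⧸ Ideal.span (Set.range (Fin.append f c))) := h.isRegularLocalRing_quotient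
  haveI hregq : IsRegularLocalRing ((S ⧸ Ideal.span (Set.range f)) ⧸
      Ideal.span (Set.range fun j => Ideal.Quotient.mk (Ideal.span (Set.range f)) (c j))) :=
    IsRegularLocalRing.of_ringEquiv e.symm
  haveI hreg1 : IsRegularLocalRing (S ⧸ Ideal.span (Set.range f)) := hf.isRegularLocalRing_quotient
  haveI hregS : IsRegularLocalRing S := h.isRegularLocalRing
  refine IsRsopPart.of_isRegularLocalRing_quotient (fun j => ?_) ?_
  · rw [← map_mk_maximalIdeal_eq (Ideal.span (Set.range f))]
    exact Ideal.mem_map_of_mem _ (by simpa using h.mem_maximalIdeal (Fin.natAdd p j))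
  · -- dimensions: all three rings are regular local, so their dimensions are natural numbers
    rw [ringKrullDim_eq_of_ringEquiv e]
    obtain ⟨dS, hdS⟩ : ∃ d : ℕ, ringKrullDim S = d := ⟨_, hregS.spanFinrank_maximalIdeal.symm⟩
    obtain ⟨d1, hd1⟩ : ∃ d : ℕ, ringKrullDim (S ⧸ Ideal.span (Set.range f)) = d :=
      ⟨_, hreg1.spanFinrank_maximalIdeal.symm⟩
    obtain ⟨d2, hd2⟩ : ∃ d : ℕ, ringKrullDim (S ⧸ Ideal.span (Set.range (Fin.append f c))) = d :=
      ⟨_, hreg2.spanFinrank_maximalIdeal.symm⟩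
    have h1 := h.ringKrullDim_quotient_add
    have h2 := hf.ringKrullDim_quotient_add
    rw [hd2, hdS] at h1
    rw [hd1, hdS] at h2
    rw [hd2, hd1]
    have e1 : d2 + (p + q) = dS := by exact_mod_cast h1
    have e2 : d1 + p = dS := by exact_mod_cast h2
    have e3 : d2 + q = d1 := by omega
    exact_mod_cast e3.le

end Quot

/-! ## §O  THE PINCH ORDER BOUND -/

section Order

variable {S : Type} [CommRing S] [IsLocalRing S] [IsNoetherianRing S]

omit [CommRing S] [IsLocalRing S] [IsNoetherianRing S] in
/-- appending the one-vectors `![z]` and `![u]` gives `![z, u]` (vector bookkeeping). [folklore] -/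
theorem vec_append_one_one (z u : S) : Fin.append ![z] ![u] = ![z, u] := by
  funext i
  refine Fin.addCases (fun j => ?_) (fun j => ?_) i
  · rw [Fin.append_left]; fin_cases j; rfl
  · rw [Fin.append_right]; fin_cases j; rfl

omit [CommRing S] [IsLocalRing S] [IsNoetherianRing S] in
/-- appending `![z, u]` and `![v]` gives `![z, u, v]` (vector bookkeeping). [folklore] -/
theorem vec_append_two_one (z u v : S) : Fin.append ![z, u] ![v] = ![z, u, v] := by
  funext i
  refine Fin.addCases (fun j => ?_) (fun j => ?_) i
  · rw [Fin.append_left]; fin_cases j <;> rfl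
  · rw [Fin.append_right]; fin_cases j; rfl

/-- `(z, u)` an r.s.o.p.-part ⇒ `ū ∉ 𝔪̄²` in `S/(z)`. [cite: Matsumura1987, Thm. 14.2] -/
theorem mk_u_not_mem_sq {z u : S} (hzu : IsRsopPart ![z, u])
    [IsLocalRing (S ⧸ Ideal.span (Set.range ![z]))] :
    Ideal.Quotient.mk (Ideal.span (Set.range ![z])) u ∉ maximalIdeal (S ⧸ Ideal.span (Set.range ![z])) ^ 2 := by
  have h := isRsopPart_tail_quotient (f := ![z]) (c := ![u]) (by rw [vec_append_one_one]; exact hzu)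
  have h' : IsRsopPart ![Ideal.Quotient.mk (Ideal.span (Set.range ![z])) u] := by
    convert h using 1
    funext j; fin_cases j; rfl
  exact h'.not_mem_sq 0

/-- `(z, u, v)` an r.s.o.p.-part ⇒ `v̿ ∉ 𝔪̿²` in `S/(z, u)`. [cite: Matsumura1987, Thm. 14.2] -/
theorem mk_v_not_mem_sq {z u v : S} (hzuv : IsRsopPart ![z, u, v])
    [IsLocalRing (S ⧸ Ideal.span (Set.range ![z, u]))] :
    Ideal.Quotient.mk (Ideal.span (Set.range ![z, u])) v ∉
      maximalIdeal (S ⧸ Ideal.span (Set.range ![z, u])) ^ 2 := by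
  have h := isRsopPart_tail_quotient (f := ![z, u]) (c := ![v]) (by rw [vec_append_two_one]; exact hzuv)
  have h' : IsRsopPart ![Ideal.Quotient.mk (Ideal.span (Set.range ![z, u])) v] := by
    convert h using 1
    funext j; fin_cases j; rfl
  exact h'.not_mem_sq 0

/-- **THE PINCH ORDER BOUND** [KERNEL]: `(z, u)` an r.s.o.p.-part, `k = 0` or `(z, u, v)` an r.s.o.p.-part, `λ` a unit
⇒ `uʳ·(λ·vᵏ + u·s) + z·b ∉ 𝔪^{r+k+1}`.  Modulo `z` (a regular local ring with `ū ∉ 𝔪̄²`): `ūʳ·W̄ ∈ 𝔪̄^{r+k+1}`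
forces `W̄ ∈ 𝔪̄^{k+1}`, i.e. `λ vᵏ ∈ (z, u) + 𝔪^{k+1}`; modulo `(z, u)` (regular local with `v̿ ∉ 𝔪̿²`): `λ̿ v̿ᵏ ∈
𝔪̿^{k+1}` is absurd. [cite: Matsumura1987, Thm. 17.10] -/
theorem pinch_not_mem_pow {z u v lam : S} {k : ℕ} (hzu : IsRsopPart ![z, u])
    (hv : k = 0 ∨ IsRsopPart ![z, u, v]) (hlam : IsUnit lam) (r : ℕ) (s b : S) :
    u ^ r * (lam * v ^ k + u * s) + z * b ∉ maximalIdeal S ^ (r + k + 1) := by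
  classical
  -- the frames `K₁ = (z)` and `K₂ = (z, u)`
  have hz1 : IsRsopPart ![z] := by
    have := hzu.comp (fun _ : Fin 1 => (0 : Fin 2)) (fun a b _ => Subsingleton.elim a b)
    convert this using 1
    funext i; fin_cases i; rfl
  haveI hreg1 : IsRegularLocalRing (S ⧸ Ideal.span (Set.range ![z])) := hz1.isRegularLocalRing_quotient
  have hubar := mk_u_not_mem_sq hzu
  set K₁ : Ideal S := Ideal.span (Set.range ![z]) with hK₁
  set W := lam * v ^ k + u * s with hW
  intro hmem
  have hzK : z ∈ K₁ := Ideal.subset_span ⟨0, rfl⟩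
  have himg : Ideal.Quotient.mk K₁ (u ^ r * W + z * b) =
      Ideal.Quotient.mk K₁ u ^ r * Ideal.Quotient.mk K₁ W := by
    rw [map_add, map_mul, map_pow, Ideal.Quotient.eq_zero_iff_mem.mpr (Ideal.mul_mem_right _ _ hzK), add_zero]
  have h1 : Ideal.Quotient.mk K₁ u ^ r * Ideal.Quotient.mk K₁ W ∈ maximalIdeal (S ⧸ K₁) ^ (r + k + 1) := by
    rw [← himg, ← map_mk_maximalIdeal_eq K₁, ← Ideal.map_pow]
    exact Ideal.mem_map_of_mem _ hmem
  -- `W̄ ∈ 𝔪̄^{k+1}`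
  have h2 : Ideal.Quotient.mk K₁ W ∈ maximalIdeal (S ⧸ K₁) ^ (k + 1) := by
    by_contra hW'
    have hur : Ideal.Quotient.mk K₁ u ^ r ∉ maximalIdeal (S ⧸ K₁) ^ (r * 1 + 1) :=
      pow_not_mem_pow_of_not_mem_pow hubar r
    have h3 := mul_not_mem_pow_of_not_mem_pow hur hW'
    rw [mul_one] at h3
    exact h3 h1
  have h3 : W ∈ K₁ ⊔ maximalIdeal S ^ (k + 1) := (mk_mem_pow_maximalIdeal_iff K₁ W (k + 1)).mp h2
  rcases hv with hk | hzuv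
  · -- `k = 0`: `W = λ + u s` would lie in `𝔪`
    subst hk
    have hWm : W ∈ maximalIdeal S := by
      refine (sup_le hz1.span_range_le_maximalIdeal ?_) h3
      rw [zero_add, pow_one]
    have hus : u * s ∈ maximalIdeal S := Ideal.mul_mem_right _ _ (hzu.mem_maximalIdeal 1)
    have hl : lam ∈ maximalIdeal S := by
      have h := Ideal.sub_mem _ hWm hus
      rwa [hW, pow_zero, mul_one, add_sub_cancel_right] at h
    exact (IsLocalRing.notMem_maximalIdeal.mpr hlam) hl
  · -- modulo `(z, u)`
    haveI hreg2 : IsRegularLocalRing (S ⧸ Ideal.span (Set.range ![z, u])) := hzu.isRegularLocalRing_quotient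
    have hvbar := mk_v_not_mem_sq hzuv
    set K₂ : Ideal S := Ideal.span (Set.range ![z, u]) with hK₂
    have hK12 : K₁ ≤ K₂ := by
      rw [hK₁, Ideal.span_le]
      rintro _ ⟨i, rfl⟩
      fin_cases i
      exact Ideal.subset_span ⟨0, rfl⟩
    have huK : u ∈ K₂ := Ideal.subset_span ⟨1, rfl⟩
    have h4 : lam * v ^ k ∈ K₂ ⊔ maximalIdeal S ^ (k + 1) := by
      have heq : lam * v ^ k = W - u * s := by rw [hW]; ring
      rw [heq]
      exact Ideal.sub_mem _ (sup_le_sup_right hK12 _ h3) (Ideal.mem_sup_left (Ideal.mul_mem_right _ _ huK))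
    have h5 : Ideal.Quotient.mk K₂ (lam * v ^ k) ∈ maximalIdeal (S ⧸ K₂) ^ (k + 1) :=
      (mk_mem_pow_maximalIdeal_iff K₂ _ _).mpr h4
    have h6 : Ideal.Quotient.mk K₂ v ^ k ∉ maximalIdeal (S ⧸ K₂) ^ (k * 1 + 1) :=
      pow_not_mem_pow_of_not_mem_pow hvbar k
    rw [mul_one] at h6
    apply h6
    rw [map_mul, map_pow] at h5
    obtain ⟨w, hw⟩ := hlam.map (Ideal.Quotient.mk K₂)
    have heq : Ideal.Quotient.mk K₂ v ^ k = ↑w⁻¹ * (Ideal.Quotient.mk K₂ lam * Ideal.Quotient.mk K₂ v ^ k) := by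
      rw [← hw, ← mul_assoc, Units.inv_mul, one_mul]
    rw [heq]
    exact Ideal.mul_mem_left _ _ h5

end Order

end Summit.ResolutionOfSingularities.ResolutionOfSingularities.Theorems.PinchTower
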